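import Summits.NavierStokesRegularity.FluidComputer.PalasekTowerRegisterGlobalHeredity
import Summits.NavierStokesRegularity.FluidComputer.PalasekTowerClayBridgePathB

/-!
# REGISTER v2.3′ AT ARBITRARY RATES: the G-layer `EpisodeBaseGAt R` / `HeredityAtGAt R k` / `HeredityFromGAt R k₀`,
# its `wide ↔` identities, the assembly and the closer for any `R : TowerRates` — and ONE definite re-tuned record
# `TowerRates.tuned = (2^24, 33/32, 12/5, 49/20)` (KERNEL SUPPORT asked by the PTB tenure planner, STATUS 2026-08-27T08:23Z (a))

Cell `ns-blowup`, seat `ns-palasek-19179-p2` (g5; holder of record of crux `EpisodeBase` = `EpisodeBaseG`,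
stmt-NavierStokesRegularity-19179). LABEL: E–C typing (KERNEL vocabulary + glue). WHAT THIS IS NOT: not Navier–Stokes evidence
— named open `Prop`s PARAMETRISED by the rates record, their assembly and closer (ported verbatim from the `wide` proofs of
`PalasekTowerRegisterGlobal.lean` / `…Heredity.lean`), and one admissible rates record; nothing is inhabited or asserted;
NO item is filed or restated here (D-0014: the items of record `EpisodeBase` / `HeredityAtOne` / `HeredityFromTwo` stay pinned to
`TowerRates.wide`; a re-base, if the S-N1 verdict orders one, is the planner's `route edit` over `…GAt TowerRates.tuned`).

## Why (planner word D-0014, 08:23Z; holder RE-TUNING BRIEF v1.2c = 19179 evidence #56)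

The kernel is generic in `R` up to the G-layer: `Schedule R`, `Stage ν R S m k`, `Margins.routeG R`, `Schedule.Pins`, `Schedule.Rigid`,
`Schedule.Quiet`, `Realisation.ofEpisodes`, `navierStokesBreakdownR3_of_step2_B (R)` (Path B, unconditional). Only `EpisodeBaseG`,
`EpisodeInductionG`, `HeredityAt`, `HeredityFrom`, `HeredityAtOne` fix `R = wide` (12 occurrences). This file supplies the
`R`-generic twins with THE SAME pins `(Λ, θ) = (8, 6/5)` and THE SAME `Rigid` constants (`c₁ = 1`, `c₂ = 5/3`, `c₅ = 4bβ`) — so that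
at `R = wide` they are the items of record DEFINITIONALLY (`Iff.rfl`) — and the closer
`navierStokesBreakdownR3_of_heredityGAt : EpisodeBaseGAt R → HeredityAtGAt R 1 → HeredityFromGAt R 2 → NavierStokesBreakdownR3`
of the same shape as the route's `closes`. The record `TowerRates.tuned` is the brief's corner made definite at the end where the
ORIGINAL pins stay admissible: `σ = N₀^{b−1} = 2^{3/4}`, speed step `F = 2^{21/20} > 2 = θc₂` (`tuned_sep`, the analogue of
`wide_sep`), `Re₀ = N₀^{β−2} = 2^{48/5} ≈ 776`, Burgers factor `B = 2^{81/20} ≈ 16.6` (the MODEL-line margins ≥ 1.2 at `tuned` are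
certified separately in `PalasekTowerBurgersTuned.lean`).

References: S. Palasek, arXiv:2605.13827 §3.3, §4 [cite: Palasek2026ElementaryModel, §3–§4]; C. L. Fefferman, Clay problem
description, (C) [cite: FeffermanClay2006, (C)].
-/

noncomputable section

namespace Summit.NavierStokesRegularity.FluidComputer.PalasekTowerClayBridge

open Set MeasureTheory Filter Topology Function
open scoped ENNReal ContDiff NNReal
open Literature.Analysis.FluidPDE

/-! ## §1 The definite re-tuned rates record -/

namespace TowerRates

/-- **The re-tuned rates record** `(N₀, b, β, α) = (2^24, 33/32, 12/5, 49/20)`: first-step lacunarity `σ = N₀^{b−1} = 2^{3/4}`,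
level-`0` core Reynolds number `Re₀ = N₀^{β−2} = 2^{48/5} ≈ 776` (wide: `5.28`), DC1 `2b = 33/16 < 12/5`, DC4 `β < 1 + √2`,
`2 < α ≤ 5/2`. [cite: Palasek2026ElementaryModel, §3 (3.2) and Rem. 1.5] -/
def tuned : TowerRates where
  N₀ := 2 ^ 24
  b := 33 / 32
  β := 12 / 5
  α := 49 / 20
  one_lt_N₀ := by norm_num
  one_lt_b := by norm_num
  two_b_lt_β := by norm_num
  β_lt_α := by norm_num
  two_lt_α := by norm_num
  α_le := by norm_num
  β_lt_one_add_sqrt_two := by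
    have h : (7 : ℝ) / 5 < Real.sqrt 2 := by
      rw [Real.lt_sqrt (by norm_num)]; norm_num
    linarith

/-- `N₀ = 2^24` as a real power. [folklore] -/
theorem tuned_N₀_eq : tuned.N₀ = (2 : ℝ) ^ (24 : ℝ) := by
  simp only [tuned]; norm_num

/-- `N_k = 2^{24·(33/32)^k}` on the tuned rates. [folklore] -/
theorem tuned_N_eq_two_rpow (k : ℕ) : tuned.N k = (2 : ℝ) ^ ((24 : ℝ) * (33 / 32 : ℝ) ^ k) := by
  show tuned.N₀ ^ (tuned.b ^ k) = _
  rw [tuned_N₀_eq, ← Real.rpow_mul (by norm_num)]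
  simp only [tuned]

/-- The first lacunarity step of the tuned rates: `σ = N₀^{b−1} = 2^{3/4}`. [folklore] -/
theorem tuned_sigma_eq : tuned.N₀ ^ (tuned.b - 1) = (2 : ℝ) ^ ((3 : ℝ) / 4) := by
  rw [tuned_N₀_eq, ← Real.rpow_mul (by norm_num)]; simp only [tuned]; norm_num

/-- The level-`0` core Reynolds number of the tuned rates: `Re₀ = N₀^{β−2} = 2^{48/5}`. [folklore] -/
theorem tuned_Re₀_eq : tuned.N₀ ^ (tuned.β - 2) = (2 : ℝ) ^ ((48 : ℝ) / 5) := by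
  rw [tuned_N₀_eq, ← Real.rpow_mul (by norm_num)]; simp only [tuned]; norm_num

/-- **Every level of the tuned rates at least DOUBLES the velocity scale**: `2 Y_k ≤ Y_{k+1}` (`N₀^{(b−1)(β−1)} = 2^{21/20} ≥ 2`;
the analogue of `wide_sep`, so the separation pin `θ c₂ = 2` and `Schedule.gap` stay admissible). [folklore] -/
theorem tuned_sep (k : ℕ) : 2 * tuned.Y k ≤ tuned.Y (k + 1) := by
  refine le_trans ?_ (tuned.base_sep_mul_Y_le_Y_succ k)
  have hY : 0 < tuned.Y k := Real.rpow_pos_of_pos (tuned.N_pos k) _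
  refine mul_le_mul_of_nonneg_right ?_ hY.le
  have hexp : (tuned.b - 1) * (tuned.β - 1) = 21 / 480 := by simp only [tuned]; norm_num
  rw [hexp, tuned_N₀_eq, ← Real.rpow_mul (by norm_num : (0 : ℝ) ≤ 2)]
  conv_lhs => rw [← Real.rpow_one 2]
  exact Real.rpow_le_rpow_of_exponent_le (by norm_num) (by norm_num)

end TowerRates

/-! ## §2 The G-layer at arbitrary rates -/

/-- **K1G at the rates `R`** (open for every `R`; never asserted): a pinned (`Λ = 8`, `θ = 6/5`), rigid, quiet schedule on the
rates `R` carries a globally anchored, strained, cored stage at level `1` at unit viscosity. At `R = wide` this is `EpisodeBaseG`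
verbatim (`episodeBaseGAt_wide_iff`). [cite: Palasek2026ElementaryModel, §4] -/
def EpisodeBaseGAt (R : TowerRates) : Prop :=
  ∃ S : Schedule R, S.Pins 8 (6 / 5) ∧ S.Rigid ∧ S.Quiet ∧ Nonempty (Stage 1 R S (Margins.routeG R) 1)

/-- **Heredity AT level `k` at the rates `R`** (open; never asserted): every globally anchored registered stage at level `k` of a
pinned, rigid, quiet schedule on `R` extends to one at level `k + 1`, at unit viscosity. At `R = wide`: `HeredityAt k`.
[cite: Palasek2026ElementaryModel, §4] -/
def HeredityAtGAt (R : TowerRates) (k : ℕ) : Prop :=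
  ∀ S : Schedule R, S.Pins 8 (6 / 5) → S.Rigid → S.Quiet →
    ∀ s : Stage 1 R S (Margins.routeG R) k, ∃ s' : Stage 1 R S (Margins.routeG R) (k + 1), s.Extends s'

/-- **Heredity FROM level `k₀` on at the rates `R`** (open; never asserted). At `R = wide`: `HeredityFrom k₀`; at `k₀ = 1` this is
K2G at `R` (`EpisodeInductionGAt`). [cite: Palasek2026ElementaryModel, §4] -/
def HeredityFromGAt (R : TowerRates) (k₀ : ℕ) : Prop :=
  ∀ S : Schedule R, S.Pins 8 (6 / 5) → S.Rigid → S.Quiet → ∀ k : ℕ, k₀ ≤ k →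
    ∀ s : Stage 1 R S (Margins.routeG R) k, ∃ s' : Stage 1 R S (Margins.routeG R) (k + 1), s.Extends s'

/-- **K2G at the rates `R`** (open; never asserted): heredity from level `1`. At `R = wide`: `EpisodeInductionG`.
[cite: Palasek2026ElementaryModel, §4] -/
def EpisodeInductionGAt (R : TowerRates) : Prop := HeredityFromGAt R 1

/-! ## §3 At `R = wide` these are the items of record, definitionally -/

/-- `EpisodeBaseGAt wide ↔ EpisodeBaseG` (definitional). [folklore] -/
theorem episodeBaseGAt_wide_iff : EpisodeBaseGAt TowerRates.wide ↔ EpisodeBaseG := Iff.rfl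

/-- `HeredityAtGAt wide k ↔ HeredityAt k` (definitional). [folklore] -/
theorem heredityAtGAt_wide_iff (k : ℕ) : HeredityAtGAt TowerRates.wide k ↔ HeredityAt k := Iff.rfl

/-- `HeredityFromGAt wide k₀ ↔ HeredityFrom k₀` (definitional). [folklore] -/
theorem heredityFromGAt_wide_iff (k₀ : ℕ) : HeredityFromGAt TowerRates.wide k₀ ↔ HeredityFrom k₀ := Iff.rfl

/-- `EpisodeInductionGAt wide ↔ EpisodeInductionG` (definitional). [folklore] -/
theorem episodeInductionGAt_wide_iff : EpisodeInductionGAt TowerRates.wide ↔ EpisodeInductionG := Iff.rfl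

/-- `HeredityAtGAt wide 1 ↔ HeredityAtOne` (definitional). [folklore] -/
theorem heredityAtGAt_wide_one_iff : HeredityAtGAt TowerRates.wide 1 ↔ HeredityAtOne := Iff.rfl

/-! ## §4 Peeling and gluing levels (ported from `PalasekTowerRegisterGlobalHeredity`) -/

variable {R : TowerRates}

/-- Heredity from `k₀` contains heredity at every level `k ≥ k₀`. [folklore] -/
theorem HeredityFromGAt.heredityAt {k₀ k : ℕ} (h : HeredityFromGAt R k₀) (hk : k₀ ≤ k) : HeredityAtGAt R k :=
  fun S hP hR hQ s => h S hP hR hQ k hk s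

/-- Heredity from a level is monotone in the level. [folklore] -/
theorem HeredityFromGAt.mono {k₀ k₁ : ℕ} (h : HeredityFromGAt R k₀) (hk : k₀ ≤ k₁) : HeredityFromGAt R k₁ :=
  fun S hP hR hQ k hk' s => h S hP hR hQ k (hk.trans hk') s

/-- Peeling one level: from `k₀` ⇔ at `k₀` and from `k₀ + 1`. [folklore] -/
theorem heredityFromGAt_iff (k₀ : ℕ) : HeredityFromGAt R k₀ ↔ HeredityAtGAt R k₀ ∧ HeredityFromGAt R (k₀ + 1) := by
  constructor
  · exact fun h => ⟨h.heredityAt le_rfl, h.mono (Nat.le_succ k₀)⟩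
  · rintro ⟨h₀, h₁⟩ S hP hR hQ k hk s
    rcases hk.eq_or_lt with rfl | hlt
    · exact h₀ S hP hR hQ s
    · exact h₁ S hP hR hQ k hlt s

/-- **The glue of the route's shape**: heredity at `1` and from `2` give K2G at `R`. [folklore] -/
theorem episodeInductionGAt_of_heredity (h₁ : HeredityAtGAt R 1) (h₂ : HeredityFromGAt R 2) : EpisodeInductionGAt R :=
  (heredityFromGAt_iff 1).2 ⟨h₁, h₂⟩

/-- Conversely K2G at `R` splits losslessly. [folklore] -/
theorem episodeInductionGAt_iff : EpisodeInductionGAt R ↔ HeredityAtGAt R 1 ∧ HeredityFromGAt R 2 :=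
  heredityFromGAt_iff 1

/-! ## §5 Assembly and closer at arbitrary rates -/

/-- **K1G ∧ K2G at `R` ⇒ the interface is inhabited at unit viscosity** (verbatim the `wide` assembly). [cite: Palasek2026ElementaryModel, §4] -/
theorem nonempty_realisation_of_episodesGAt (h₁ : EpisodeBaseGAt R) (h₂ : EpisodeInductionGAt R) :
    Nonempty (Realisation 1 R) := by
  obtain ⟨S, hP, hR, hQ, ⟨s₁⟩⟩ := h₁
  exact ⟨Realisation.ofEpisodes S s₁ (fun n s => h₂ S hP hR hQ (n + 1) (by omega) s)⟩

/-- K1G ∧ K2G at `R` ⇒ Palasek's Step 2 for the rates `R` (all viscosities, by covariance). [cite: Palasek2026ElementaryModel, §4] -/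
theorem palasekStep2_of_episodesGAt (h₁ : EpisodeBaseGAt R) (h₂ : EpisodeInductionGAt R) : PalasekStep2 R := by
  obtain ⟨W⟩ := nonempty_realisation_of_episodesGAt h₁ h₂
  exact palasekStep2_of_realisation one_pos W

/-- **CLOSER at arbitrary rates, in the shape of the route's `closes`** (Path B, unconditional uniqueness): K1G at `R`, heredity at
`1` and from `2` at `R` ⇒ Fefferman's (C). [cite: FeffermanClay2006, (C)] -/
theorem navierStokesBreakdownR3_of_heredityGAt (h₁ : EpisodeBaseGAt R) (h₂ : HeredityAtGAt R 1) (h₃ : HeredityFromGAt R 2) :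
    Summit.NavierStokesRegularity.NavierStokesRegularity.NavierStokesBreakdownR3 :=
  navierStokesBreakdownR3_of_step2_B R (palasekStep2_of_episodesGAt h₁ (episodeInductionGAt_of_heredity h₂ h₃))

/-- The same closer from K1G ∧ K2G at `R`. [cite: FeffermanClay2006, (C)] -/
theorem navierStokesBreakdownR3_of_episodesGAt (h₁ : EpisodeBaseGAt R) (h₂ : EpisodeInductionGAt R) :
    Summit.NavierStokesRegularity.NavierStokesRegularity.NavierStokesBreakdownR3 :=
  navierStokesBreakdownR3_of_step2_B R (palasekStep2_of_episodesGAt h₁ h₂)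

-- (At `R = wide` the generic closer is `navierStokesBreakdownR3_of_base_heredityAtOne_heredityFrom_two'` of
-- `PalasekTowerHeredityOrBreakdown.lean`, by the `Iff.rfl` identities of §3.)

end Summit.NavierStokesRegularity.FluidComputer.PalasekTowerClayBridge

end
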